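import Mathlib
import HarnessLib
import Summits.Ventures.LatticeQCDFlow.Exactness.SUNStoutLatticeLayer
import Summits.Ventures.LatticeQCDFlow.Exactness.SUNStoutLayerEquivariance
import Summits.Ventures.LatticeQCDFlow.Exactness.EquivariantJacobianGaugeInvariance

/-!
# A finite SCHEDULE of masked `SU(N)` stout steps — the engine's residual flow — is gauge equivariant, a measurable automorphism, and every continuous exact Jacobian of it is a class function

HONEST FRAMING: exact (Metropolis-corrected) sampling algorithms for lattice gauge theory;
figures of merit are autocorrelation/cost numbers at stated couplings and volumes; no
continuum-physics claim.

Venture `LatticeQCDFlow` (cell pub-lqcd), topic `Exactness`; FANOUT row 10 (`eng-equiv`; engine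
`flows_jax/residual_flow.py` = a trainable schedule of masked stout steps cycling through the
direction masks, `κ < 1` by construction; `equiv/flow.py` composition with accumulated log-det; the
flow-level unit tests "gauge equivariance of 16-layer / 8-layer flows", "log-det gauge invariance").
NEW WORK of the cell at FLOW level, complementing the layer-level files `SUNStoutLayerEquivariance`
(one stout step is equivariant), `SUNStoutLatticeLayer` (one step is a measurable automorphism) and
`SUNStoutLayerClassFunction` (a step's continuous exact Jacobians are class functions), with the
general principle `EquivariantJacobianGaugeInvariance.isGaugeInvariant_of_hasJacobian`.  The schedule
is written exactly as in `SUNStoutScheduleJacobian` (a list of indices into a family of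
(mask, parameter) pairs, head applied first), so the results apply to the same map whose pinched exact
Jacobian that file produces.  Nothing is cited as a fact; no number; no definition.

* `isGaugeEquivariant_foldr_comp` — a composite of equivariant layers (any list) is equivariant;
* **`isGaugeEquivariant_stoutSchedule`** — every finite schedule of masked stout steps with constant
  parameters `rs i` is `IsGaugeEquivariant` (every `n`, `d`, `L`, masks, parameters);
* **`exists_measurableEquiv_stoutSchedule`** — under the frozen-staple hypotheses `h1`–`h6` and the
  certificate `2(d−1)|rs i| < 1` for every step, the schedule is `⇑Ψ` for a measurable automorphism
  `Ψ` of `GaugeConfig d L SU(n)`;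
* **`isGaugeInvariant_jacobian_stoutSchedule`** — hence every continuous `j ≥ 0` with
  `HasJacobian (⊗_e Haar_{SU(n)}) (schedule) (ofReal ∘ j)` is a class function: the residual FLOW's
  booked log-det is gauge invariant whenever it is continuous and exact.
-/

noncomputable section

namespace Summit.Ventures.LatticeQCDFlow.Exactness

open Literature.MathematicalPhysics.QuantumFieldTheory
open Literature.MathematicalPhysics.QuantumFieldTheory.Luscher2010
open MeasureTheory
open scoped Matrix ENNReal

variable {d L n : ℕ} [NeZero L]

omit [NeZero L] in
/-- **A composite of gauge-equivariant layers is gauge equivariant** (any list of layers, folded as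
`G ∘ F_i`, head applied first). -/
theorem isGaugeEquivariant_foldr_comp {G : Type*} [Group G] {ι : Type*}
    (F : ι → GaugeConfig d L G → GaugeConfig d L G) (hF : ∀ i, IsGaugeEquivariant (F i)) (sched : List ι) :
    IsGaugeEquivariant (sched.foldr (fun i (H : GaugeConfig d L G → GaugeConfig d L G) => H ∘ F i) id) := by
  induction sched with
  | nil => exact IsGaugeEquivariant.id
  | cons i rest ih =>
    simp only [List.foldr_cons]
    exact ih.comp (hF i)

omit [NeZero L] in
/-- **Every finite schedule of masked `SU(n)` stout steps is gauge equivariant.** -/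
theorem isGaugeEquivariant_stoutSchedule {ι : Type*} (ps : ι → Edge d L → Prop) [∀ i, DecidablePred (ps i)]
    (rs : ι → ℝ) (sched : List ι) :
    IsGaugeEquivariant (sched.foldr (fun i (G : GaugeConfig d L (Matrix.specialUnitaryGroup (Fin n) ℂ) →
          GaugeConfig d L (Matrix.specialUnitaryGroup (Fin n) ℂ)) =>
        G ∘ fun (V : GaugeConfig d L (Matrix.specialUnitaryGroup (Fin n) ℂ)) (e : Edge d L) =>
          if ps i e then
            (⟨NormedSpace.exp ((rs i : ℂ) • suProj (plaquetteLoopSum V e.1 e.2)),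
                exp_smul_suProj_mem (rs i) (plaquetteLoopSum V e.1 e.2)⟩ :
              Matrix.specialUnitaryGroup (Fin n) ℂ) * V e
          else V e) id) :=
  isGaugeEquivariant_foldr_comp
    (fun i (V : GaugeConfig d L (Matrix.specialUnitaryGroup (Fin n) ℂ)) (e : Edge d L) =>
      if ps i e then
        (⟨NormedSpace.exp ((rs i : ℂ) • suProj (plaquetteLoopSum V e.1 e.2)),
            exp_smul_suProj_mem (rs i) (plaquetteLoopSum V e.1 e.2)⟩ :
          Matrix.specialUnitaryGroup (Fin n) ℂ) * V e
      else V e)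
    (fun i => isGaugeEquivariant_sunStoutLayer (ps i) (fun _ _ => rs i) (fun _ _ _ _ => rfl)) sched

/-- **Every finite schedule of masked `SU(n)` stout steps is a measurable automorphism** of
`GaugeConfig d L SU(n)` (frozen-staple masks `h1`–`h6`, certificate `2(d−1)|rs i| < 1` per step). -/
theorem exists_measurableEquiv_stoutSchedule {ι : Type*} (ps : ι → Edge d L → Prop) [∀ i, DecidablePred (ps i)]
    (rs : ι → ℝ) (sched : List ι)
    (h1 : ∀ i e, ps i e → ∀ ν, ν ≠ e.2 → ¬ps i (e.1.shift e.2, ν))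
    (h2 : ∀ i e, ps i e → ∀ ν, ν ≠ e.2 → ¬ps i (e.1.shift ν, e.2))
    (h3 : ∀ i e, ps i e → ∀ ν, ν ≠ e.2 → ¬ps i (e.1, ν))
    (h4 : ∀ i e, ps i e → ∀ ν, ν ≠ e.2 → ¬ps i ((e.1 - Pi.single ν 1).shift e.2, ν))
    (h5 : ∀ i e, ps i e → ∀ ν, ν ≠ e.2 → ¬ps i (e.1 - Pi.single ν 1, e.2))
    (h6 : ∀ i e, ps i e → ∀ ν, ν ≠ e.2 → ¬ps i (e.1 - Pi.single ν 1, ν))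
    (hr : ∀ i, 2 * (d - 1 : ℝ) * |rs i| < 1) :
    ∃ Ψ : GaugeConfig d L (Matrix.specialUnitaryGroup (Fin n) ℂ) ≃ᵐ
        GaugeConfig d L (Matrix.specialUnitaryGroup (Fin n) ℂ),
      ⇑Ψ = sched.foldr (fun i (G : GaugeConfig d L (Matrix.specialUnitaryGroup (Fin n) ℂ) →
          GaugeConfig d L (Matrix.specialUnitaryGroup (Fin n) ℂ)) =>
        G ∘ fun (V : GaugeConfig d L (Matrix.specialUnitaryGroup (Fin n) ℂ)) (e : Edge d L) =>
          if ps i e then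
            (⟨NormedSpace.exp ((rs i : ℂ) • suProj (plaquetteLoopSum V e.1 e.2)),
                exp_smul_suProj_mem (rs i) (plaquetteLoopSum V e.1 e.2)⟩ :
              Matrix.specialUnitaryGroup (Fin n) ℂ) * V e
          else V e) id := by
  induction sched with
  | nil => exact ⟨MeasurableEquiv.refl _, rfl⟩
  | cons i rest ih =>
    obtain ⟨Ψr, hΨr⟩ := ih
    obtain ⟨Ψl, hΨl⟩ := exists_measurableEquiv_sunStoutLatticeLayer (n := n) (ps i) (fun _ _ => rs i)
      (fun _ _ => rs i) (fun _ _ _ => rfl) (fun _ _ => continuous_const)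
      (h1 i) (h2 i) (h3 i) (h4 i) (h5 i) (h6 i) (fun _ _ _ => hr i)
    refine ⟨Ψl.trans Ψr, ?_⟩
    simp only [List.foldr_cons]
    rw [← hΨr, MeasurableEquiv.coe_trans, hΨl]

/-- **Every continuous exact Jacobian of a stout schedule is a class function** (the residual flow's
booked log-det is gauge invariant whenever it is continuous and exact). -/
theorem isGaugeInvariant_jacobian_stoutSchedule {ι : Type*} (ps : ι → Edge d L → Prop) [∀ i, DecidablePred (ps i)]
    (rs : ι → ℝ) (sched : List ι)
    (h1 : ∀ i e, ps i e → ∀ ν, ν ≠ e.2 → ¬ps i (e.1.shift e.2, ν))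
    (h2 : ∀ i e, ps i e → ∀ ν, ν ≠ e.2 → ¬ps i (e.1.shift ν, e.2))
    (h3 : ∀ i e, ps i e → ∀ ν, ν ≠ e.2 → ¬ps i (e.1, ν))
    (h4 : ∀ i e, ps i e → ∀ ν, ν ≠ e.2 → ¬ps i ((e.1 - Pi.single ν 1).shift e.2, ν))
    (h5 : ∀ i e, ps i e → ∀ ν, ν ≠ e.2 → ¬ps i (e.1 - Pi.single ν 1, e.2))
    (h6 : ∀ i e, ps i e → ∀ ν, ν ≠ e.2 → ¬ps i (e.1 - Pi.single ν 1, ν))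
    (hr : ∀ i, 2 * (d - 1 : ℝ) * |rs i| < 1)
    {Φ : GaugeConfig d L (Matrix.specialUnitaryGroup (Fin n) ℂ) → GaugeConfig d L (Matrix.specialUnitaryGroup (Fin n) ℂ)}
    (hΦ : Φ = sched.foldr (fun i (G : GaugeConfig d L (Matrix.specialUnitaryGroup (Fin n) ℂ) →
          GaugeConfig d L (Matrix.specialUnitaryGroup (Fin n) ℂ)) =>
        G ∘ fun (V : GaugeConfig d L (Matrix.specialUnitaryGroup (Fin n) ℂ)) (e : Edge d L) =>
          if ps i e then
            (⟨NormedSpace.exp ((rs i : ℂ) • suProj (plaquetteLoopSum V e.1 e.2)),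
                exp_smul_suProj_mem (rs i) (plaquetteLoopSum V e.1 e.2)⟩ :
              Matrix.specialUnitaryGroup (Fin n) ℂ) * V e
          else V e) id)
    {j : GaugeConfig d L (Matrix.specialUnitaryGroup (Fin n) ℂ) → ℝ} (hj : Continuous j) (hj0 : ∀ U, 0 ≤ j U)
    (h : HasJacobian (Measure.pi fun _ : Edge d L => haarProbability (Matrix.specialUnitaryGroup (Fin n) ℂ)) Φ
      (fun U => ENNReal.ofReal (j U))) :
    IsGaugeInvariant j := by
  haveI : SecondCountableTopology (Matrix (Fin n) (Fin n) ℂ) :=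
    inferInstanceAs (SecondCountableTopology (Fin n → Fin n → ℂ))
  haveI : SecondCountableTopology (Matrix.specialUnitaryGroup (Fin n) ℂ) :=
    Topology.IsEmbedding.subtypeVal.secondCountableTopology
  obtain ⟨Ψ, hΨ⟩ := exists_measurableEquiv_stoutSchedule (n := n) ps rs sched h1 h2 h3 h4 h5 h6 hr
  have hequiv : IsGaugeEquivariant (Ψ : GaugeConfig d L (Matrix.specialUnitaryGroup (Fin n) ℂ) →
      GaugeConfig d L (Matrix.specialUnitaryGroup (Fin n) ℂ)) := by
    rw [hΨ]
    exact isGaugeEquivariant_stoutSchedule ps rs sched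
  rw [hΦ, ← hΨ] at h
  exact isGaugeInvariant_of_hasJacobian hequiv hj hj0 h

end Summit.Ventures.LatticeQCDFlow.Exactness

end
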